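import Literature.Probability.RandomPlanarGeometry.SLERealAvoidance
import Literature.Probability.RandomPlanarGeometry.SLELogDerivMartingale
import HarnessLib

/-!
# Transience of the SLE_κ trace for `0 < κ < 4` (Rohde–Schramm, Thm. 7.1), from Cor. 3.5

Trunk T-STOCH. S. Rohde, O. Schramm, *Basic properties of SLE*, Ann. of Math. 161 (2005),
Theorem 7.1 ("For all `κ ≠ 8` the SLE_κ trace `γ(t)` is transient a.s.") in the range
`0 < κ < 4`, assembled from the tree:

* `ae_exists_forall_log_norm_deriv_sub_le` — for `0 < κ < 4` and `0 < y < x`, almost surely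
  `sup_t (log |g_t'(x)| - log |g_t'(y)|) < ∞` (the logarithmic martingale of
  `SLELogDerivMartingale`, `ae_exists_forall_integral_realFlow_rate_le`, read through
  `Loewner.log_norm_deriv_map_ofReal_sub_eq_integral`);
* `ae_forall_ne_zero_notMem_closure_range_sleTrace_of_lt_four` — **Lemma 7.2 for `κ < 4` in
  the simultaneous form**: if SLE_κ is generated by a curve, a.s. no nonzero real point lies in
  `cl γ[0, ∞)` (Koebe route, `SLERealAvoidance`; non-swallowing for `κ ≤ 4`,
  `ae_sle_swallowingTime_eq_top_of_le_four`); the per-point instance of the named fact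
  `RohdeSchramm2005_lem72` for `κ < 4` under `HasSLETrace κ` is
  `ae_ofReal_notMem_closure_range_sleTrace_of_lt_four`;
* `ae_zero_notMem_closure_sleTrace_image_Ici_of_lt_four` — the step "`0 ∉ cl γ[1, ∞)` a.s."
  (`SLETransienceSimple`), and
* `tendsto_norm_sleTrace_atTop_of_lt_four` / `tendsto_norm_sleTrace_atTop_of_cor35_of_lt_four` —
  **a.s. `|γ(t)| → ∞`** for `0 < κ < 4`, given the trace and the shifted trace, in particular
  from Rohde–Schramm's Cor. 3.5 alone (`RohdeSchramm2005_cor35`, which the tree reduces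
  Thm. 5.1 to).

With this file the target fact `tendsto_norm_sleTrace_atTop` is, for `0 < κ < 4`, reduced to
`RohdeSchramm2005_cor35 preWienerMeasure` (the derivative expectation bound of Cor. 3.5).

## References

* S. Rohde, O. Schramm, *Basic properties of SLE*, Ann. of Math. 161 (2005): Cor. 3.5,
  Lemma 7.2, Theorem 7.1 and its proof (pp. 909–911).
-/

noncomputable section

open Set Filter Topology MeasureTheory ProbabilityTheory Complex Metric
open scoped NNReal

namespace Literature.Probability.RandomPlanarGeometry

variable {κ : ℝ≥0}

/-- **`sup_t (log |g_t'(x)| - log |g_t'(y)|) < ∞` a.s.** for `0 < κ < 4` and `0 < y < x`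
(`ae_exists_forall_integral_realFlow_rate_le` + `Loewner.log_norm_deriv_map_ofReal_sub_eq_integral`).
[cite: RohdeSchramm2005, proof of Lemma 7.2 (p. 909)] -/
theorem ae_exists_forall_log_norm_deriv_sub_le (hκ0 : 0 < κ) (hκ : κ < 4) {x y : ℝ}
    (hy : 0 < y) (hyx : y < x) :
    ∀ᵐ ω ∂Process.preWienerMeasure, ∃ L : ℝ, ∀ t : ℝ≥0,
      Real.log ‖deriv (sleMap κ ω t) x‖ - Real.log ‖deriv (sleMap κ ω t) y‖ ≤ L := by
  filter_upwards [ae_exists_forall_integral_realFlow_rate_le hκ0 hκ hy hyx.le] with ω hω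
  obtain ⟨hT, L, hL⟩ := hω
  refine ⟨L, fun t ↦ ?_⟩
  have hyW : sleDriving κ ω 0 < y := by rw [sleDriving_zero]; exact hy
  have ht : (t : WithTop ℝ≥0) < Loewner.swallowingTime (sleDriving κ ω) y := by
    rw [hT]; exact WithTop.coe_lt_top t
  have h := Loewner.log_norm_deriv_map_ofReal_sub_eq_integral (continuous_sleDriving κ ω) hyW hyx.le ht
  simp only [sleMap]
  rw [h]
  exact hL t

/-- **Lemma 7.2 for `0 < κ < 4`, simultaneous form**: if SLE_κ is generated by a curve, then
almost surely no nonzero real point lies in `cl γ[0, ∞)`, `γ = sleTrace κ ω`.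
Rohde–Schramm (2005), Lemma 7.2 (p. 909), by the Koebe route (`SLERealAvoidance`,
`LoewnerRealKoebe`, `SLELogDerivMartingale`). [cite: RohdeSchramm2005, Lemma 7.2] -/
theorem ae_forall_ne_zero_notMem_closure_range_sleTrace_of_lt_four (hκ0 : 0 < κ) (hκ : κ < 4)
    (h0 : HasSLETrace κ) :
    ∀ᵐ ω ∂Process.preWienerMeasure, ∀ x : ℝ, x ≠ 0 → (x : ℂ) ∉ closure (range (sleTrace κ ω)) :=
  ae_forall_ne_zero_notMem_closure_range_sleTrace h0
    (fun _ hy ↦ ae_sle_swallowingTime_eq_top_of_le_four hκ0 hκ.le hy)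
    (fun _ _ hy hyx ↦ ae_exists_forall_log_norm_deriv_sub_le hκ0 hκ hy hyx)

/-- **Lemma 7.2 for `0 < κ < 4`, as printed** (per point): for `x ∈ ℝ ∖ {0}`, a.s.
`x ∉ cl γ[0, ∞)` — the instance of the named fact `RohdeSchramm2005_lem72` for `κ < 4`, under
the existence of the trace (`HasSLETrace κ`; without it `sleTrace` is the junk constant path, for
which the statement is empty of content). [cite: RohdeSchramm2005, Lemma 7.2] -/
theorem ae_ofReal_notMem_closure_range_sleTrace_of_lt_four (hκ0 : 0 < κ) (hκ : κ < 4)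
    (h0 : HasSLETrace κ) {x : ℝ} (hx : x ≠ 0) :
    ∀ᵐ ω ∂Process.preWienerMeasure, (x : ℂ) ∉ closure (range (sleTrace κ ω)) := by
  filter_upwards [ae_forall_ne_zero_notMem_closure_range_sleTrace_of_lt_four hκ0 hκ h0] with ω hω
  exact hω x hx

/-- **`0 ∉ cl γ[1, ∞)` a.s. for `0 < κ < 4`** (Rohde–Schramm (2005), proof of Thm. 7.1, case
`κ ≤ 4`, p. 911), given the trace (`h0`) and the shifted trace after time `1` (`hs`).
[cite: RohdeSchramm2005, proof of Thm 7.1 (p. 911)] -/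
theorem ae_zero_notMem_closure_sleTrace_image_Ici_of_lt_four (hκ0 : 0 < κ) (hκ : κ < 4)
    (h0 : HasSLETrace κ)
    (hs : ∀ᵐ ω ∂Process.preWienerMeasure,
      ∃ γ, Loewner.IsGeneratedByCurve (fun u ↦ sleDriving κ ω (1 + u) - sleDriving κ ω 1) γ) :
    ∀ᵐ ω ∂Process.preWienerMeasure, (0 : ℂ) ∉ closure (sleTrace κ ω '' Ici 1) :=
  ae_zero_notMem_closure_sleTrace_image_Ici_of_forall_notMem_closure h0 hκ.le hs
    (ae_forall_ne_zero_notMem_closure_range_sleTrace_of_lt_four hκ0 hκ h0)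

/-- **Transience of the SLE_κ trace, `0 < κ < 4`** (Rohde–Schramm (2005), Thm. 7.1): if SLE_κ
is generated by a curve and so is, a.s., the chain of the increments of `√κ B` after time `1`,
then almost surely `|γ(t)| → ∞` as `t → ∞`. [cite: RohdeSchramm2005, Thm 7.1] -/
theorem tendsto_norm_sleTrace_atTop_of_lt_four (hκ0 : 0 < κ) (hκ : κ < 4) (h0 : HasSLETrace κ)
    (hs : ∀ᵐ ω ∂Process.preWienerMeasure,
      ∃ γ, Loewner.IsGeneratedByCurve (fun u ↦ sleDriving κ ω (1 + u) - sleDriving κ ω 1) γ) :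
    ∀ᵐ ω ∂Process.preWienerMeasure, Tendsto (fun t ↦ ‖sleTrace κ ω t‖) atTop atTop :=
  tendsto_norm_sleTrace_atTop_of_forall_notMem_closure h0 hκ.le hs
    (ae_forall_ne_zero_notMem_closure_range_sleTrace_of_lt_four hκ0 hκ h0)

/-- **Transience of the SLE_κ trace, `0 < κ < 4`, from Cor. 3.5 alone**: Rohde–Schramm's
Cor. 3.5 on the canonical space (`RohdeSchramm2005_cor35`, to which the tree reduces Thm. 5.1)
supplies the trace and all shifted traces; everything else in Theorem 7.1 for `0 < κ < 4` is now
proved in `Literature`. [cite: RohdeSchramm2005, Thm 7.1] -/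
theorem tendsto_norm_sleTrace_atTop_of_cor35_of_lt_four
    (h : RohdeSchramm2005_cor35 Process.preWienerMeasure) (hκ0 : 0 < κ) (hκ : κ < 4) :
    ∀ᵐ ω ∂Process.preWienerMeasure, Tendsto (fun t ↦ ‖sleTrace κ ω t‖) atTop atTop :=
  tendsto_norm_sleTrace_atTop_of_cor35_of_forall_notMem_closure h hκ0.ne' hκ.le
    (ae_forall_ne_zero_notMem_closure_range_sleTrace_of_lt_four hκ0 hκ
      (hasSLETrace_of_ne_eight_of_cor35 h (by intro h8; rw [h8] at hκ; norm_num at hκ)))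

end Literature.Probability.RandomPlanarGeometry
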